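import Mathlib
import Literature.NumberTheory.Transcendental.KZCalculus
import Summits.KontsevichZagierPeriods.KontsevichZagierPeriods.Theses.HermiteRigidity
import Summits.KontsevichZagierPeriods.KontsevichZagierPeriods.Theorems.HermiteRigidityGenusTwoCycleTransferPushforwardDimOne
import Summits.KontsevichZagierPeriods.KontsevichZagierPeriods.Theorems.HermiteRigidityTwoTorsionTransferMove

/-!
# `TwoTorsionTransfer` (item stmt-KontsevichZagierPeriods-3413, route HermiteRigidity)

For `q₂, q₃ ∈ ℚ` with `0 < q₂³ − 27 q₃²` (three real roots `e₃ < e₂ < e₁` of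
`f(x) = 4x³ − q₂x − q₃`) the two Kontsevich–Zagier integral representations

* `r  = [σ'', 1/√f]`, `σ'' = {x | f x > 0 ∧ ∀ t > x, f t > 0} = (e₁, ∞)` (half the real period),
* `r' = [σ , 1/√f]`, `σ  = {x | f x > 0 ∧ ∃ t > x, f t < 0} = (e₃, e₂)` (the other half),

are **equivalent by ONE move of rule (2)** (`KZ.changeOfVariablesRel`): the change of variables is
the translation by the `2`-torsion point `(e₂, 0)`, `Φ(x) = e₂ + (e₂ − e₁)(e₂ − e₃)/(x − e₂)`
(Whittaker–Watson §20.33), which maps `(e₁, ∞)` injectively onto `(e₃, e₂)`, is `ℚ`-semialgebraic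
there (one Tarski–Seidenberg projection, `phi_semialgebraic`), and satisfies
`f(Φ(x)) = Φ′(x)² f(x)` (`cubic_phi`), so that the Jacobian weight `|Φ′(x)|/√f(Φ(x))` is exactly
`1/√f(x)`. All the real algebra is in `HermiteRigidityTwoTorsionTransferMove.lean`; the
one-dimensional derivative/determinant bookkeeping (`hasFDerivAt_fin_one`, `det_smul_id_fin_one`)
is reused from `HermiteRigidityGenusTwoCycleTransferPushforwardDimOne.lean`.

`TwoTorsionTransfer_proof` concludes the route declaration
`Summit.KontsevichZagierPeriods.KontsevichZagierPeriods.Theses.HermiteRigidity.TwoTorsionTransfer`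
by name.

References: E. T. Whittaker, G. N. Watson, *A Course of Modern Analysis* (1927), §20.33;
M. Kontsevich, D. Zagier, *Periods* (2001), §1.2 rule (2).
-/

noncomputable section

open Set MeasureTheory
open Literature.NumberTheory.Transcendental Literature.ModelTheory.ExponentialFields

namespace Summit.KontsevichZagierPeriods.HermiteRigidity.TwoTorsionTransfer

/-! ### The route declaration -/

/-- **`TwoTorsionTransfer`** (item stmt-KontsevichZagierPeriods-3413 of route HermiteRigidity): for
`q₂, q₃ ∈ ℚ` with `0 < q₂³ − 27q₃²`, any two KZ integral representations `r = [(e₁, ∞), 1/√f]` and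
`r' = [(e₃, e₂), 1/√f]` of the two halves of the real period of `y² = f(x) = 4x³ − q₂x − q₃` are
KZ-equivalent, by the single rule-2 move `Φ(x) = e₂ + (e₂ − e₁)(e₂ − e₃)/(x − e₂)` (translation by
the `2`-torsion point `(e₂, 0)`; `f(Φ x) = Φ′(x)² f(x)` makes the Jacobian weight `1/√f`).
[cite: WhittakerWatson1927, §20.33] [cite: KontsevichZagier2001, §1.2 rule (2)] -/
theorem TwoTorsionTransfer_proof :
    Summit.KontsevichZagierPeriods.KontsevichZagierPeriods.Theses.HermiteRigidity.TwoTorsionTransfer := by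
  unfold Summit.KontsevichZagierPeriods.KontsevichZagierPeriods.Theses.HermiteRigidity.TwoTorsionTransfer
  intro q₂ q₃ hdisc f σ σ'' r r' hr hri hr' hr'i
  obtain ⟨e₁, e₂, h21, h32, hA, hB⟩ := exists_roots (q₂ : ℝ) (q₃ : ℝ) hdisc
  have hf : ∀ x, f x = 4 * (x - e₁) * (x - e₂) * (x + e₁ + e₂) := fun x => by
    show 4 * x ^ 3 - (q₂ : ℝ) * x - (q₃ : ℝ) = _
    rw [hA, hB]; ring
  have ha : (e₂ - e₁) * (e₁ + 2 * e₂) ≠ 0 :=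
    (mul_neg_of_neg_of_pos (by linarith) (by linarith)).ne
  -- the two domains
  have hr0 : r.domain = {p : Fin 1 → ℝ | 0 < f (p 0) ∧ ∀ t : ℝ, p 0 < t → 0 < f t} := hr
  have hr0' : r'.domain = {p : Fin 1 → ℝ | 0 < f (p 0) ∧ ∃ t : ℝ, p 0 < t ∧ f t < 0} := hr'
  have hri' : EqOn r.integrand (fun p => 1 / Real.sqrt (f (p 0))) r.domain := by
    rw [hr]; exact hri
  have hr'i' : EqOn r'.integrand (fun p => 1 / Real.sqrt (f (p 0))) r'.domain := by
    rw [hr']; exact hr'i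
  have hdom : r.domain = {p : Fin 1 → ℝ | e₁ < p 0} := by
    rw [hr0]
    ext p
    have := Set.ext_iff.mp (setOf_pos_forall_eq h21 h32) (p 0)
    simpa only [mem_setOf_eq, mem_Ioi, hf] using this
  have hdom' : r'.domain = {p : Fin 1 → ℝ | -e₁ - e₂ < p 0 ∧ p 0 < e₂} := by
    rw [hr0']
    ext p
    have := Set.ext_iff.mp (setOf_pos_exists_eq h21 h32) (p 0)
    simpa only [mem_setOf_eq, mem_Ioo, hf] using this
  have hS : IsSemialgebraic ℚ {p : Fin 1 → ℝ | e₁ < p 0} := hdom ▸ r.isSemialgebraic_domain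
  -- the move
  set Φ : (Fin 1 → ℝ) → (Fin 1 → ℝ) :=
    fun p _ => e₂ + (e₂ - e₁) * (e₁ + 2 * e₂) / (p 0 - e₂) with hΦ_def
  set Φ' : (Fin 1 → ℝ) → ((Fin 1 → ℝ) →L[ℝ] (Fin 1 → ℝ)) :=
    fun p => (-((e₂ - e₁) * (e₁ + 2 * e₂)) / (p 0 - e₂) ^ 2) •
      ContinuousLinearMap.id ℝ (Fin 1 → ℝ) with hΦ'_def
  have hdet : ∀ p, (Φ' p).det = -((e₂ - e₁) * (e₁ + 2 * e₂)) / (p 0 - e₂) ^ 2 := fun p =>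
    GenusTwoCycleTransfer.det_smul_id_fin_one _
  have hΦsa : IsSemialgebraicMapOn ℚ r.domain Φ := by
    rw [hdom]
    exact IsSemialgebraicMapOn.of_forall hS fun _ => phi_semialgebraic h21 h32 hA hB hS
  have hderiv : ∀ p ∈ r.domain, HasFDerivWithinAt Φ (Φ' p) r.domain p := by
    intro p hp
    rw [hdom] at hp
    have hp2 : p 0 ≠ e₂ := (h21.trans hp).ne'
    exact (GenusTwoCycleTransfer.hasFDerivAt_fin_one _ _ p
      (hasDerivAt_phi ((e₂ - e₁) * (e₁ + 2 * e₂)) e₂ (p 0) hp2)).hasFDerivWithinAt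
  have hinj : InjOn Φ r.domain := by
    intro p hp p' hp' h
    rw [hdom] at hp hp'
    have hp2 : p 0 ≠ e₂ := (h21.trans hp).ne'
    have hp2' : p' 0 ≠ e₂ := (h21.trans hp').ne'
    have h0 := congr_fun h 0
    simp only [hΦ_def] at h0
    funext i
    rw [Fin.fin_one_eq_zero i, ← phi_phi ha hp2, h0, phi_phi ha hp2']
  have himage : r'.domain = Φ '' r.domain := by
    rw [hdom, hdom', hΦ_def, image_phi_eq h21 h32]
  have hjac : ∀ p ∈ r.domain, r.integrand p = r'.integrand (Φ p) * |(Φ' p).det| := by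
    intro p hp
    have hp' : Φ p ∈ r'.domain := himage ▸ mem_image_of_mem Φ hp
    rw [hri' hp, hr'i' hp', hdet p]
    rw [hdom] at hp
    have hp1 : e₁ < p 0 := hp
    have hp2 : p 0 ≠ e₂ := (h21.trans hp1).ne'
    have hfp : 0 < f (p 0) := by
      rw [hf]; exact (cubic_pos_iff h21 h32 _).mpr (Or.inr hp1)
    have hφ' : -((e₂ - e₁) * (e₁ + 2 * e₂)) / (p 0 - e₂) ^ 2 ≠ 0 :=
      div_ne_zero (neg_ne_zero.mpr ha) (pow_ne_zero 2 (sub_ne_zero.mpr hp2))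
    have key : f (Φ p 0) = (-((e₂ - e₁) * (e₁ + 2 * e₂)) / (p 0 - e₂) ^ 2) ^ 2 * f (p 0) := by
      rw [hf, hf]
      exact cubic_phi e₁ e₂ (p 0) hp2
    have habs : |(-((e₂ - e₁) * (e₁ + 2 * e₂)) / (p 0 - e₂) ^ 2)| ≠ 0 := abs_ne_zero.mpr hφ'
    show 1 / Real.sqrt (f (p 0)) = 1 / Real.sqrt (f (Φ p 0)) * _
    rw [key, Real.sqrt_mul' _ hfp.le, Real.sqrt_sq_eq_abs, one_div, one_div, mul_inv_rev,
      inv_mul_cancel_right₀ habs]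
  exact KZ.changeOfVariablesRel_subset_relations
    ⟨1, r, r', Φ, Φ', hΦsa, hderiv, hinj, himage, hjac, rfl⟩

end Summit.KontsevichZagierPeriods.HermiteRigidity.TwoTorsionTransfer

end
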